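import Mathlib
import Summits.KontsevichZagierPeriods.Zeta5Search.WedgeDictionary
import HarnessLib

/-!
# The single-pole sub-family of `₈π₈`: `F̃₇(2m; 0, m, m, m, m, m, m) = 2ζ(5) − 2H_m^{(5)}` for every `m`

HONEST FRAMING: systematic search; no irrationality claim unless certified.

Cell `pub-zeta5`, family-designer seat `fam-brown8` generation 4 (staged for filing next to `OddFamilyZeta3Free`).
For the dual parameters `b = (2m; 0, m⁶)` the summand of Brown–Zudilin's series (34) collapses to a single pole,
`R_b(t) = 2/(t+m+1)^5` (`isPFData_bTail`: the one-entry table `c_{4,m} = 2` IS the partial-fraction data), so the canonical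
coefficients are `(U, W, V) = (2, 0, 2H_m^{(5)})` (`coeff_bTail`) and, by the tree's decomposition theorem,
`F̃₇(2m; 0, m⁶) = 2ζ(5) − 2H_m^{(5)}` for EVERY `m : ℕ` (`vwpDual_bTail`) — an infinite `ζ(3)`-free but trivial family
(the `ζ(5)`-coefficient is constantly `2`; these "linear forms" are the tails `2Σ_{k>m} k^{-5}` and prove nothing).
Brown's first two `ζ(3)`-free examples (arXiv:1412.6508 §5.3.3: `I(1,0,0,1,0,0,0,0) = 2ζ(5) − 2`,
`I(2,0,0,2,0,0,0,0) = 2ζ(5) − 33/16`) are the cases `m = 1, 2` (`vwpDual_bTail_one`, `vwpDual_bTail_two`; in Brown's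
coordinates `(2m;0,m⁶)` is `a = (m,0,0,m,0,0,0)`, `b₅₈ = 0`, prefactor (35) `= m!/m! = 1`).  The cell's exhaustive census
(FAMILY.md v4 §3.3: all `526 436` parameter multisets with `b₀ ≤ 18`) finds that, up to the `S₇`-symmetry of `F̃₇`, these and
the single sporadic point `(8; 2,3,3,3,3,3,5)` are the ONLY `ζ(3)`-free parameters with non-zero `ζ(5)`-coefficient — that
census is a computation recorded there, not a theorem of this file.
-/

noncomputable section

open Finset Polynomial

namespace Summit.KontsevichZagierPeriods.Zeta5Search.Brown8.OddFamily

open Summit.KontsevichZagierPeriods.Zeta5Search.DualSeries (InBox numPoly eval_numPoly)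
open Summit.KontsevichZagierPeriods.Zeta5Search.WedgeDictionary (IsPFData coeffU coeffW coeffV coeffU_eq coeffW_eq
  coeffV_eq vwp_decomposition)
open Literature.NumberTheory.Irrationality.BrownZudilin2022 (vwpDual)
open Literature.NumberTheory.Transcendental (zetaValue)
open Literature.NumberTheory.Transcendental.BallRivoal (pfEval poch harm)

/-- The dual parameter `b = (2m; 0, m, m, m, m, m, m)` (junk `0` beyond index `7`). -/
def bTail (m : ℕ) : ℕ → ℤ := fun j => if j = 0 then 2 * (m : ℤ) else if j = 1 then 0 else if j ≤ 7 then (m : ℤ) else 0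

/-- Its partial-fraction data: the single entry `c_{4,m} = 2` (`R_b(t) = 2/(t+m+1)^5`). -/
def cTail (m : ℕ) : ℕ → ℕ → ℚ := fun o p => if o = 4 ∧ p = m then 2 else 0

/-- Auxiliary fact `bTail_zero` (designer helper; docstring added by the filing lane, mathematics verbatim). -/
theorem bTail_zero (m : ℕ) : bTail m 0 = 2 * (m : ℤ) := by simp [bTail]

/-- Auxiliary fact `bTail_one` (designer helper; docstring added by the filing lane, mathematics verbatim). -/
theorem bTail_one (m : ℕ) : bTail m 1 = 0 := by simp [bTail]

/-- Auxiliary fact `bTail_val` (designer helper; docstring added by the filing lane, mathematics verbatim). -/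
theorem bTail_val (m : ℕ) {j : ℕ} (h2 : 2 ≤ j) (h7 : j ≤ 7) : bTail m j = m := by
  simp only [bTail]
  rw [if_neg (by omega), if_neg (by omega), if_pos h7]

/-- Auxiliary fact `bTail_toNat_zero` (designer helper; docstring added by the filing lane, mathematics verbatim). -/
theorem bTail_toNat_zero (m : ℕ) : (bTail m 0).toNat = 2 * m := by
  rw [bTail_zero, show (2 * (m : ℤ)) = ((2 * m : ℕ) : ℤ) by push_cast; ring, Int.toNat_natCast]

/-- `(2m; 0, m⁶)` satisfies the hypotheses of the decomposition theorem (`0 ≤ b_j ≤ b₀+1`, `Σ b_j = 6m ≤ 6m + 1`). -/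
theorem inBox_bTail (m : ℕ) : InBox (bTail m) ∧ ∑ j ∈ range 7, bTail m (j + 1) ≤ 3 * bTail m 0 + 1 := by
  refine ⟨⟨by rw [bTail_zero]; positivity, fun j hj => ?_⟩, ?_⟩
  · have hj' := mem_range.1 hj
    interval_cases j
    · rw [bTail_one, bTail_zero]; omega
    all_goals rw [bTail_val m (by norm_num) (by norm_num), bTail_zero]; omega
  · simp only [sum_range_succ, sum_range_zero, Nat.reduceAdd, bTail_one, bTail_zero,
      bTail_val m (show 2 ≤ 2 by norm_num) (by norm_num), bTail_val m (show 2 ≤ 3 by norm_num) (by norm_num),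
      bTail_val m (show 2 ≤ 4 by norm_num) (by norm_num), bTail_val m (show 2 ≤ 5 by norm_num) (by norm_num),
      bTail_val m (show 2 ≤ 6 by norm_num) (by norm_num), bTail_val m (show 2 ≤ 7 by norm_num) (by norm_num)]
    omega

/-! ### Pochhammer bookkeeping -/

/-- Auxiliary Pochhammer evaluation `poch_zero_right` (docstring added by the filing lane, mathematics verbatim). -/
theorem poch_zero_right (x : ℚ) : poch x 0 = 1 := by simp [poch]

/-- `(x)_{2m+1} = (x)_m · (x+m) · (x+m+1)_m`. -/
theorem poch_two_mul_add_one (x : ℚ) (m : ℕ) :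
    poch x (2 * m + 1) = poch x m * (x + m) * poch (x + m + 1) m := by
  unfold poch
  rw [show 2 * m + 1 = m + (m + 1) by ring, prod_range_add, prod_range_succ' (fun k => x + ((m + k : ℕ) : ℚ))]
  have h : ∏ k ∈ range m, (x + ((m + (k + 1) : ℕ) : ℚ)) = ∏ s ∈ range m, (x + m + 1 + s) :=
    prod_congr rfl fun k _ => by push_cast; ring
  rw [h]
  push_cast
  ring

/-- `numPoly_{(2m;0,m⁶)}(t+1) = (2t+2m+2)·((t+1)_m (t+m+2)_m)^6`. -/
theorem eval_numPoly_bTail (m : ℕ) (t : ℚ) :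
    ((numPoly (bTail m)).comp (X + C 1)).eval t =
      (2 * t + 2 * m + 2) * (poch (t + 1) m * poch (t + 1 + m + 1) m) ^ 6 := by
  rw [eval_comp, eval_add, eval_X, eval_C, eval_numPoly]
  simp only [prod_range_succ, prod_range_zero, one_mul, Nat.reduceAdd, bTail_zero, bTail_one,
    bTail_val m (show 2 ≤ 2 by norm_num) (by norm_num), bTail_val m (show 2 ≤ 3 by norm_num) (by norm_num),
    bTail_val m (show 2 ≤ 4 by norm_num) (by norm_num), bTail_val m (show 2 ≤ 5 by norm_num) (by norm_num),
    bTail_val m (show 2 ≤ 6 by norm_num) (by norm_num), bTail_val m (show 2 ≤ 7 by norm_num) (by norm_num),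
    Int.toNat_natCast, Int.toNat_zero, poch_zero_right]
  have harg : (t + 1 + ((2 * (m : ℤ) - (m : ℤ) + 1 : ℤ) : ℚ)) = t + 1 + m + 1 := by push_cast; ring
  rw [harg]
  push_cast
  ring

/-- `cTail m` IS the partial-fraction data of `R_{(2m;0,m⁶)}(t) = 2/(t+m+1)^5`. -/
theorem isPFData_bTail (m : ℕ) : IsPFData (bTail m) (cTail m) := by
  intro t ht
  rw [bTail_toNat_zero] at ht
  have hm : t + m + 1 ≠ 0 := ht m (by omega)
  have hm' : t + 1 + m ≠ 0 := by intro h; apply hm; linarith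
  have hA : poch (t + 1) m ≠ 0 := prod_ne_zero_iff.2 fun s hs => by
    have h := ht s (by have := mem_range.1 hs; omega)
    intro h'; apply h; linarith
  have hB : poch (t + 1 + m + 1) m ≠ 0 := prod_ne_zero_iff.2 fun s hs => by
    have h := ht (m + 1 + s) (by have := mem_range.1 hs; omega)
    intro h'; apply h; push_cast; linarith
  have hL : pfEval (bTail m 0).toNat 6 (cTail m) t = 2 / (t + m + 1) ^ 5 := by
    rw [bTail_toNat_zero]
    unfold pfEval
    rw [sum_eq_single_of_mem m (by simp; omega) (fun p _ hp => sum_eq_zero fun o _ => by simp [cTail, hp])]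
    rw [sum_eq_single_of_mem 4 (by simp) (fun o _ ho => by simp [cTail, ho])]
    simp [cTail]
  rw [hL, eval_numPoly_bTail, bTail_toNat_zero, poch_two_mul_add_one]
  rw [div_eq_div_iff (pow_ne_zero _ hm) (pow_ne_zero _ (mul_ne_zero (mul_ne_zero hA hm') hB))]
  ring

/-- The canonical coefficients of `(2m;0,m⁶)`: `U = 2`, `W = 0`, `V = 2H_m^{(5)}`. -/
theorem coeff_bTail (m : ℕ) : coeffU (bTail m) = 2 ∧ coeffW (bTail m) = 0 ∧ coeffV (bTail m) = 2 * harm 5 m := by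
  have hB := bTail_toNat_zero m
  refine ⟨?_, ?_, ?_⟩
  · rw [coeffU_eq (isPFData_bTail m), hB, sum_eq_single_of_mem m (by simp; omega) (fun p _ hp => by simp [cTail, hp])]
    simp [cTail]
  · rw [coeffW_eq (isPFData_bTail m), hB]
    exact sum_eq_zero fun p _ => by simp [cTail]
  · rw [coeffV_eq (isPFData_bTail m), hB, sum_eq_single_of_mem 4 (by simp) (fun o _ ho => sum_eq_zero fun p _ => by
      simp [cTail, ho])]
    rw [sum_eq_single_of_mem m (by simp; omega) (fun p _ hp => by simp [cTail, hp])]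
    simp [cTail]

/-- **The single-pole family**: `F̃₇(2m; 0, m, m, m, m, m, m) = 2ζ(5) − 2H_m^{(5)}` for every `m`. -/
theorem vwpDual_bTail (m : ℕ) : vwpDual 7 (bTail m) = 2 * zetaValue 5 - 2 * (harm 5 m : ℝ) := by
  obtain ⟨hU, hW, hV⟩ := coeff_bTail m
  rw [(vwp_decomposition _ (inBox_bTail m).1 (inBox_bTail m).2).2, hU, hW, hV]
  push_cast
  ring

/-- `m = 1`: `F̃₇(2; 0, 1⁶) = 2ζ(5) − 2` — Brown's first example (`b = (2;1,0,1,1,1,1,1)` up to the `S₇`-symmetry; here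
the zero sits in slot `1`). -/
theorem vwpDual_bTail_one : vwpDual 7 (bTail 1) = 2 * zetaValue 5 - 2 := by
  rw [vwpDual_bTail]; simp [harm]

/-- `m = 2`: `F̃₇(4; 0, 2⁶) = 2ζ(5) − 33/16` — Brown's second example. -/
theorem vwpDual_bTail_two : vwpDual 7 (bTail 2) = 2 * zetaValue 5 - 33 / 16 := by
  rw [vwpDual_bTail]; simp [harm, sum_range_succ]; norm_num

end Summit.KontsevichZagierPeriods.Zeta5Search.Brown8.OddFamily
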